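import Summits.QuantumFields.QCD.Theses.SpectralDefectExtinction

/-!
# Route SpectralDefectExtinction — Assembly (item stmt-QuantumFields-17607, formerly stmt-QuantumFields-8973)

The assembly of route `route-QuantumFields-SpectralDefectExtinction` (sub-problem `QCD` of the
summit `QuantumFields`) is pure logic. After the 2026-08-16 re-type repair (route rev 5–7: the
bridge `ExtinctionBuildsQCD` restated to the threshold body, the crux `ChiralDescent` added) it reads

`TipNoBinding → WegnerEstimate → TipPricing → ExtinctionBuildsQCD → ChiralDescent → QCD`.

`TipPricing` is by definition the implication `TipNoBinding → WegnerEstimate → WindowExtinction`,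
so the first three hypotheses give `WindowExtinction`; for `N_f = 2` and `N_f = 3` separately the
bridge `ExtinctionBuildsQCD` turns the clean witness into massive QCD above a threshold, which
`ChiralDescent` turns into the re-typed `QCDOf N_f` (`IsChiralAtZero` included); the conjunction
`QCDOf 2 ∧ QCDOf 3` is `QCD` — exactly the route's deciding theorem
`closes : WindowExtinction → ExtinctionBuildsQCD → ChiralDescent → QCD` fed with `WindowExtinction`.
No analysis, no named facts; axioms ⊆ {propext, Classical.choice, Quot.sound}.

The theorem keeps its name `spectralDefectExtinctionAssembly_proof`; its statement is literally the
(restated) route decl `Assembly`, and only the proof term changed (one more hypothesis `hC`).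
-/

namespace Summit.QuantumFields.QCD.Theorems

open Summit.QuantumFields.QCD.Theses.SpectralDefectExtinction

/-- **Assembly of route SpectralDefectExtinction** (item stmt-QuantumFields-17607):
`TipNoBinding → WegnerEstimate → TipPricing → ExtinctionBuildsQCD → ChiralDescent → QCD`.
Proof: `TipPricing` turns `TipNoBinding` and `WegnerEstimate` into `WindowExtinction`; at `N_f = 2`
and at `N_f = 3` the bridge `ExtinctionBuildsQCD` gives massive QCD above a threshold and
`ChiralDescent` gives the re-typed `QCDOf N_f`; the pair is `QCD = QCDOf 2 ∧ QCDOf 3`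
(the route's deciding theorem `closes` applied to `WindowExtinction`). -/
theorem spectralDefectExtinctionAssembly_proof : Summit.QuantumFields.QCD.Theses.SpectralDefectExtinction.Assembly := by
  unfold Summit.QuantumFields.QCD.Theses.SpectralDefectExtinction.Assembly
  intro hT hW hP hB hC
  have hSD : WindowExtinction := hP hT hW
  exact ⟨hC 2 (Or.inl rfl) (hB 2 (Or.inl rfl) (hSD 2 (Or.inl rfl))),
    hC 3 (Or.inr rfl) (hB 3 (Or.inr rfl) (hSD 3 (Or.inr rfl)))⟩

end Summit.QuantumFields.QCD.Theorems
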